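import Mathlib
import HarnessLib
import Literature.RepresentationTheory.Semisimple.BurnsideMatrixSpan
import Literature.NumberTheory.GaloisRepresentations.ContinuousRep

/-!
# Burnside trace lemma (crux stmt-Langlands-15111, line Sketch, stub `stub_existsTraceNeZero`)

Pure group / linear algebra helper for the "non-twist witness" of the odd base-change sector:
if `ρ : G → GL₂(ℂ)` restricted along `φ : H → G` is irreducible and `φ(H) ≠ G`, then some
`g ∉ φ(H)` has `tr ρ(g) ≠ 0`.

Proof: by Burnside's theorem
(`Literature.RepresentationTheory.Semisimple.span_eq_top_of_isIrreducible`) the matrices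
`ρ(φ h)` span `M₂(ℂ)`.  Pick `g₁ ∉ φ(H)`; if every `g ∉ φ(H)` had trace zero, then, as
`g₁ φ(h) ∉ φ(H)` for all `h`, the linear functional `X ↦ tr(ρ(g₁) X)` would vanish on the
spanning set, hence everywhere, and `X := ρ(g₁)⁻¹` gives `tr 1 = 2 = 0`, absurd.
-/

noncomputable section

open scoped MatrixGroups
open Literature.NumberTheory.GaloisRepresentations

-- `Summit.Langlands.Langlands.…`: summit = sub-problem name (D-0017 nested layout), not a typo.
set_option linter.dupNamespace false

namespace Summit.Langlands.Langlands.Theorems.ArtinWeightRealisationLevel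

/-- **Burnside trace lemma.**  If `ρ : G → GL₂(ℂ)` restricted along `φ : H → G` is
irreducible and `φ(H) ≠ G`, some `g ∉ φ(H)` has `tr ρ(g) ≠ 0`: the matrices `ρ(φ h)` span `M₂(ℂ)`
(Burnside), so `X ↦ tr(ρ(g₁) X)` cannot vanish on all of them for `g₁ ∉ φ(H)`.  (Header = the
signature registered on the crux item, verbatim.) [folklore] -/
theorem stub_existsTraceNeZero : ∀ {G H : Type} [Group G] [Group H] (ρ : G →* GL (Fin 2) ℂ)
    (φ : H →* G), φ.range ≠ ⊤ → Representation.IsIrreducible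
      ((Literature.NumberTheory.GaloisRepresentations.glStdRepresentation (Fin 2) ℂ).comp
        (ρ.comp φ)) →
      ∃ g : G, g ∉ φ.range ∧ ((ρ g : GL (Fin 2) ℂ) : Matrix (Fin 2) (Fin 2) ℂ).trace ≠ 0 := by
  intro G H _ _ ρ φ hH hirr
  classical
  -- Burnside: the matrices `ρ (φ h)` span `M₂(ℂ)`
  have hspan : Submodule.span ℂ (Set.range fun h : H =>
      ((ρ.comp φ h : GL (Fin 2) ℂ) : Matrix (Fin 2) (Fin 2) ℂ)) = ⊤ := by
    haveI := hirr
    exact Literature.RepresentationTheory.Semisimple.span_eq_top_of_isIrreducible (ρ.comp φ)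
  -- an element outside `φ(H)`
  obtain ⟨g₁, hg₁⟩ : ∃ g₁ : G, g₁ ∉ φ.range := by
    by_contra h
    push Not at h
    exact hH ((Subgroup.eq_top_iff' _).mpr h)
  by_contra hall
  push Not at hall
  -- the functional `X ↦ tr (ρ g₁ * X)` vanishes on the spanning set, hence everywhere
  set M₁ : Matrix (Fin 2) (Fin 2) ℂ := ((ρ g₁ : GL (Fin 2) ℂ) : Matrix (Fin 2) (Fin 2) ℂ)
    with hM₁
  set L : Matrix (Fin 2) (Fin 2) ℂ →ₗ[ℂ] ℂ :=
    (Matrix.traceLinearMap (Fin 2) ℂ ℂ) ∘ₗ (LinearMap.mulLeft ℂ M₁) with hL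
  have hLapply : ∀ X : Matrix (Fin 2) (Fin 2) ℂ, L X = (M₁ * X).trace := fun X => rfl
  have hker : Submodule.span ℂ (Set.range fun h : H =>
      ((ρ.comp φ h : GL (Fin 2) ℂ) : Matrix (Fin 2) (Fin 2) ℂ)) ≤ LinearMap.ker L := by
    refine Submodule.span_le.mpr ?_
    rintro _ ⟨h, rfl⟩
    have hnot : g₁ * φ h ∉ φ.range := by
      intro hmem
      apply hg₁
      have hmem' := φ.range.mul_mem hmem (φ.range.inv_mem ⟨h, rfl⟩)
      rwa [mul_inv_cancel_right] at hmem'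
    have h0 := hall _ hnot
    rw [map_mul, Units.val_mul] at h0
    simpa [LinearMap.mem_ker, hLapply, hM₁] using h0
  rw [hspan, top_le_iff, LinearMap.ker_eq_top] at hker
  -- evaluate at `X := (ρ g₁)⁻¹`
  have h1 : L (((ρ g₁)⁻¹ : GL (Fin 2) ℂ) : Matrix (Fin 2) (Fin 2) ℂ) = 0 := by
    rw [hker, LinearMap.zero_apply]
  rw [hLapply, hM₁, Units.mul_inv, Matrix.trace_one, Fintype.card_fin] at h1
  norm_num at h1

end Summit.Langlands.Langlands.Theorems.ArtinWeightRealisationLevel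

end
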